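import Mathlib

/-!
# Route `JensenPolynomials`, FAR crux `XiWindowZeroFreeRelFar` (B1-rel) — the truncated binomial series
`T_M(w) = Σ_{k ≤ M} binom(M − ½, k) w^k`, I: coefficients, crude bound, the ODE and the segment identity
(RH-FREE; cell rh-jensen, HUMAN RULING D-0040; input of the truncation stub `stub_junk` (S2) of theory g8's far-Gumbel
skeleton for item `stmt-RiemannHypothesis-19465`)

In the kernel-integral representation `μ_{2M}·F_M(s) = ∫₀^∞ Φ(u) u^{2M} T_M(s c_M/((M−½)u²)) du`
(`WindowEGF.integralRepr`) the polynomial `T_M` is the binomial series of `(1+w)^{M−½}` truncated at degree `M`.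
Replacing `T_M(w)` by `(1+w)^{M−½}` (the «bulk» branch) costs nothing for `|w| < 1`, `Re w > −1/2`; but for
`|w| ≳ 1` near `arg w = π` (the band `u ∈ [0.52υ, 0.65υ]` of the `u`-integral when `arg s ≈ π`) the TERMWISE bound
`|T_M(w)| ≤ (1+|w|)^M` loses a factor `e^{+0.128 M}` against the main term at `θ = 7/20`, and one needs the
CANCELLATION inside `T_M`: the «endpoint» (Szegő) branch of size `binom(M−½,M)·|w|^{M}·poly(M)`. This is obtained
(part III, `…TruncatedBinomialTwoBranch`) from the first-order ODE
`(1+w)T_M′(w) − (M−½)T_M(w) = ½·binom(M−½,M)·w^M` proved here, integrated along `0 → |w| → arc(|w|, 0 → arg w)`.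

* §1 the coefficients `binom(M−½, k) = (descPochhammer ℝ k).eval (M − ½)/k!` (the shape of `integralRepr`, kept
  INLINE throughout — no definitions): positivity for `k ≤ M`, the recursion, `≤ M.choose k`;
* §2 the crude bound `‖T_M(w)‖ ≤ (1+‖w‖)^M`;
* §3 the ODE (pure algebra), `T_M(−1)`, and the derivative of `G_M(w) = T_M(w)(1+w)^{−(M−½)}` off the cut `w ≤ −1`;
* §4 the segment `[0, r]`: `G_M(r) = 1 + ½·binom(M−½,M)·I_M(r)`, `0 ≤ I_M(r) = ∫₀^r x^M(1+x)^{−M−½}dx ≤ r^{M+1}/(M+1)`.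

WHAT THIS IS NOT: elementary analysis of a polynomial; nothing here bears on the zeros of `ζ` or the truth of RH.
References: G. Szegő, *Über eine Eigenschaft der Exponentialreihe*, Sitzungsber. Berl. Math. Ges. 23 (1924)
(zeros of sections of power series); [GORZPNAS2019] for the window EGF.
-/

noncomputable section
-- D-0017: `Summit.RiemannHypothesis.RiemannHypothesis.…` duplicates the namespace BY DESIGN (single-problem summit).
set_option linter.dupNamespace false

namespace Summit.RiemannHypothesis.RiemannHypothesis.Theorems.JensenPolynomials.WindowEGF

open Complex MeasureTheory Set Filter Finset
open scoped Real Topology ComplexConjugate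

/-! ## 1. The coefficients `binom(M − ½, k)` -/


/-- `binom(M−½, 0) = 1`. -/
theorem halfBinom_zero (M : ℕ) : ((descPochhammer ℝ 0).eval ((M : ℝ) - 1 / 2) / (Nat.factorial 0 : ℝ)) = 1 := by
  simp

/-- The recursion `(k+1)·binom(M−½, k+1) = (M − ½ − k)·binom(M−½, k)`. -/
theorem halfBinom_succ (M k : ℕ) :
    ((descPochhammer ℝ (k + 1)).eval ((M : ℝ) - 1 / 2) / (Nat.factorial (k + 1) : ℝ)) = ((descPochhammer ℝ k).eval ((M : ℝ) - 1 / 2) / (Nat.factorial k : ℝ)) * (((M : ℝ) - 1 / 2 - k) / (k + 1)) := by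
  simp only [descPochhammer_succ_eval, Nat.factorial_succ, Nat.cast_mul, Nat.cast_add, Nat.cast_one]
  have hk : ((k : ℝ) + 1) ≠ 0 := by positivity
  have hf : ((Nat.factorial k : ℕ) : ℝ) ≠ 0 := by exact_mod_cast (Nat.factorial_pos k).ne'
  field_simp

/-- `(k+1)·binom(M−½,k+1) = (M−½−k)·binom(M−½,k)`, multiplied out. -/
theorem succ_mul_halfBinom_succ (M k : ℕ) :
    ((k : ℝ) + 1) * ((descPochhammer ℝ (k + 1)).eval ((M : ℝ) - 1 / 2) / (Nat.factorial (k + 1) : ℝ)) = (((M : ℝ) - 1 / 2) - k) * ((descPochhammer ℝ k).eval ((M : ℝ) - 1 / 2) / (Nat.factorial k : ℝ)) := by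
  rw [halfBinom_succ]
  have hk : ((k : ℝ) + 1) ≠ 0 := by positivity
  field_simp

/-- Positivity: `binom(M−½, k) > 0` for `k ≤ M` (every factor `M − ½ − i`, `i < k ≤ M`, is `≥ ½`). -/
theorem halfBinom_pos {M k : ℕ} (hk : k ≤ M) : 0 < ((descPochhammer ℝ k).eval ((M : ℝ) - 1 / 2) / (Nat.factorial k : ℝ)) := by
  induction k with
  | zero => simp
  | succ k ih =>
    rw [halfBinom_succ]
    have h1 : 0 < ((descPochhammer ℝ k).eval ((M : ℝ) - 1 / 2) / (Nat.factorial k : ℝ)) := ih (by omega)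
    have h2 : (0 : ℝ) < ((M : ℝ) - 1 / 2 - k) := by
      have : (k : ℝ) + 1 ≤ M := by exact_mod_cast hk
      linarith
    positivity

/-- Comparison with the integer binomial: `binom(M−½, k) ≤ binom(M, k)` for `k ≤ M`. -/
theorem halfBinom_le_choose {M k : ℕ} (hk : k ≤ M) : ((descPochhammer ℝ k).eval ((M : ℝ) - 1 / 2) / (Nat.factorial k : ℝ)) ≤ (M.choose k : ℝ) := by
  induction k with
  | zero => simp
  | succ k ih =>
    have hkM : k ≤ M := by omega
    have h1 := ih hkM
    have h0 : 0 < ((descPochhammer ℝ k).eval ((M : ℝ) - 1 / 2) / (Nat.factorial k : ℝ)) := halfBinom_pos hkM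
    rw [halfBinom_succ]
    -- binom(M, k+1) = binom(M, k) · (M − k)/(k + 1)
    have hchoose : ((M.choose (k + 1) : ℕ) : ℝ) = (M.choose k : ℝ) * (((M : ℝ) - k) / (k + 1)) := by
      -- (M.choose k) * (M - k) = M.choose (k+1) * (k+1)
      have h' : (M.choose (k + 1) : ℝ) * ((k : ℝ) + 1) = (M.choose k : ℝ) * ((M : ℝ) - k) := by
        have := Nat.choose_succ_right_eq M k
        -- M.choose (k+1) * (k+1) = M.choose k * (M - k)
        have hsub : ((M - k : ℕ) : ℝ) = (M : ℝ) - k := by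
          rw [Nat.cast_sub hkM]
        have hcast : ((M.choose (k + 1) * (k + 1) : ℕ) : ℝ) = ((M.choose k * (M - k) : ℕ) : ℝ) := by
          exact_mod_cast this
        push_cast at hcast
        rw [hsub] at hcast
        linarith [hcast]
      have hk1 : ((k : ℝ) + 1) ≠ 0 := by positivity
      field_simp
      linarith [h']
    rw [hchoose]
    have hfac : ((M : ℝ) - 1 / 2 - k) / (k + 1) ≤ ((M : ℝ) - k) / (k + 1) := by
      apply div_le_div_of_nonneg_right _ (by positivity)
      linarith
    have hfac0 : 0 ≤ ((M : ℝ) - 1 / 2 - k) / (k + 1) := by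
      apply div_nonneg _ (by positivity)
      have : (k : ℝ) + 1 ≤ M := by exact_mod_cast hk
      linarith
    calc ((descPochhammer ℝ k).eval ((M : ℝ) - 1 / 2) / (Nat.factorial k : ℝ)) * (((M : ℝ) - 1 / 2 - k) / (k + 1))
        ≤ (M.choose k : ℝ) * (((M : ℝ) - 1 / 2 - k) / (k + 1)) := by gcongr
      _ ≤ (M.choose k : ℝ) * (((M : ℝ) - k) / (k + 1)) := by gcongr

/-! ## 2. The truncated binomial series and the crude bound -/


/-- **Crude bound** `‖T_M(w)‖ ≤ (1 + ‖w‖)^M` (all coefficients are positive and `≤ binom(M,k)`). -/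
theorem norm_truncBinom_le (M : ℕ) (w : ℂ) : ‖(∑ k ∈ Finset.range (M + 1), ((((descPochhammer ℝ k).eval ((M : ℝ) - 1 / 2) / (Nat.factorial k : ℝ)) : ℝ) : ℂ) * w ^ k)‖ ≤ (1 + ‖w‖) ^ M := by
  calc ‖∑ k ∈ Finset.range (M + 1), ((((descPochhammer ℝ k).eval ((M : ℝ) - 1 / 2) / (Nat.factorial k : ℝ)) : ℝ) : ℂ) * w ^ k‖
      ≤ ∑ k ∈ Finset.range (M + 1), ‖((((descPochhammer ℝ k).eval ((M : ℝ) - 1 / 2) / (Nat.factorial k : ℝ)) : ℝ) : ℂ) * w ^ k‖ := norm_sum_le _ _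
    _ = ∑ k ∈ Finset.range (M + 1), ((descPochhammer ℝ k).eval ((M : ℝ) - 1 / 2) / (Nat.factorial k : ℝ)) * ‖w‖ ^ k := by
        refine Finset.sum_congr rfl fun k hk ↦ ?_
        have hkM : k ≤ M := Nat.lt_succ_iff.mp (Finset.mem_range.mp hk)
        rw [norm_mul, norm_pow, Complex.norm_real, Real.norm_of_nonneg (halfBinom_pos hkM).le]
    _ ≤ ∑ k ∈ Finset.range (M + 1), (M.choose k : ℝ) * ‖w‖ ^ k := by
        refine Finset.sum_le_sum fun k hk ↦ ?_
        have hkM : k ≤ M := Nat.lt_succ_iff.mp (Finset.mem_range.mp hk)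
        gcongr
        exact halfBinom_le_choose hkM
    _ = (1 + ‖w‖) ^ M := by
        rw [show (1 + ‖w‖) = ‖w‖ + 1 by ring, add_pow]
        refine Finset.sum_congr rfl fun k hk ↦ ?_
        rw [one_pow, mul_one, mul_comm]

/-! ## 3. The ODE `(1+w)T_M′ − (M−½)T_M = ½·binom(M−½,M)·w^M` -/


/-- `T_M` is complex-differentiable with derivative `T_M′`. -/
theorem hasDerivAt_truncBinom (M : ℕ) (w : ℂ) : HasDerivAt (fun w : ℂ ↦ (∑ k ∈ Finset.range (M + 1), ((((descPochhammer ℝ k).eval ((M : ℝ) - 1 / 2) / (Nat.factorial k : ℝ)) : ℝ) : ℂ) * w ^ k)) (∑ k ∈ Finset.range (M + 1), ((((descPochhammer ℝ k).eval ((M : ℝ) - 1 / 2) / (Nat.factorial k : ℝ)) : ℝ) : ℂ) * ((k : ℂ) * w ^ (k - 1))) w := by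
  have h : HasDerivAt (fun y : ℂ ↦ ∑ k ∈ Finset.range (M + 1), ((((descPochhammer ℝ k).eval ((M : ℝ) - 1 / 2) / (Nat.factorial k : ℝ)) : ℝ) : ℂ) * y ^ k)
      (∑ k ∈ Finset.range (M + 1), ((((descPochhammer ℝ k).eval ((M : ℝ) - 1 / 2) / (Nat.factorial k : ℝ)) : ℝ) : ℂ) * ((k : ℂ) * w ^ (k - 1))) w :=
    HasDerivAt.fun_sum fun k _ ↦ (hasDerivAt_pow k w).const_mul _
  exact h

/-- `T_M` is continuous. -/
theorem continuous_truncBinom (M : ℕ) : Continuous (fun w : ℂ ↦ (∑ k ∈ Finset.range (M + 1), ((((descPochhammer ℝ k).eval ((M : ℝ) - 1 / 2) / (Nat.factorial k : ℝ)) : ℝ) : ℂ) * w ^ k)) := by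
  fun_prop

/-- The recursion of the coefficients, cast to `ℂ`. -/
theorem succ_mul_halfBinom_succ_complex (M k : ℕ) :
    ((k : ℂ) + 1) * ((((descPochhammer ℝ (k + 1)).eval ((M : ℝ) - 1 / 2) / (Nat.factorial (k + 1) : ℝ)) : ℝ) : ℂ) =
      ((((M : ℝ) - 1 / 2 : ℝ) : ℂ) - k) * ((((descPochhammer ℝ k).eval ((M : ℝ) - 1 / 2) / (Nat.factorial k : ℝ)) : ℝ) : ℂ) := by
  have h := succ_mul_halfBinom_succ M k
  have h' : (((((k : ℝ) + 1) * ((descPochhammer ℝ (k + 1)).eval ((M : ℝ) - 1 / 2) / (Nat.factorial (k + 1) : ℝ)) : ℝ)) : ℂ) =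
      (((((M : ℝ) - 1 / 2) - k) * ((descPochhammer ℝ k).eval ((M : ℝ) - 1 / 2) / (Nat.factorial k : ℝ)) : ℝ) : ℂ) := by rw [h]
  push_cast at h' ⊢
  exact h'

/-- The ODE identity on partial sums: for every `m`,
`(1+w)·Σ_{k≤m} c_k k w^{k−1} = (M−½)·Σ_{k≤m} c_k w^k − (M−½−m)·c_m w^m` (`c_k = binom(M−½,k)`). -/
theorem ode_partial (M : ℕ) (w : ℂ) (m : ℕ) :
    (1 + w) * ∑ k ∈ Finset.range (m + 1), ((((descPochhammer ℝ k).eval ((M : ℝ) - 1 / 2) / (Nat.factorial k : ℝ)) : ℝ) : ℂ) * ((k : ℂ) * w ^ (k - 1)) =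
      ((((M : ℝ) - 1 / 2 : ℝ) : ℂ)) * ∑ k ∈ Finset.range (m + 1), ((((descPochhammer ℝ k).eval ((M : ℝ) - 1 / 2) / (Nat.factorial k : ℝ)) : ℝ) : ℂ) * w ^ k -
        (((((M : ℝ) - 1 / 2 : ℝ) : ℂ)) - m) * ((((descPochhammer ℝ m).eval ((M : ℝ) - 1 / 2) / (Nat.factorial m : ℝ)) : ℝ) : ℂ) * w ^ m := by
  induction m with
  | zero => simp
  | succ m ih =>
    have e1 : ∑ k ∈ Finset.range (m + 1 + 1), ((((descPochhammer ℝ k).eval ((M : ℝ) - 1 / 2) / (Nat.factorial k : ℝ)) : ℝ) : ℂ) * ((k : ℂ) * w ^ (k - 1)) =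
        ∑ k ∈ Finset.range (m + 1), ((((descPochhammer ℝ k).eval ((M : ℝ) - 1 / 2) / (Nat.factorial k : ℝ)) : ℝ) : ℂ) * ((k : ℂ) * w ^ (k - 1)) +
          ((((descPochhammer ℝ (m + 1)).eval ((M : ℝ) - 1 / 2) / (Nat.factorial (m + 1) : ℝ)) : ℝ) : ℂ) * ((((m + 1 : ℕ)) : ℂ) * w ^ (m + 1 - 1)) :=
      Finset.sum_range_succ _ _
    have e2 : ∑ k ∈ Finset.range (m + 1 + 1), ((((descPochhammer ℝ k).eval ((M : ℝ) - 1 / 2) / (Nat.factorial k : ℝ)) : ℝ) : ℂ) * w ^ k =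
        ∑ k ∈ Finset.range (m + 1), ((((descPochhammer ℝ k).eval ((M : ℝ) - 1 / 2) / (Nat.factorial k : ℝ)) : ℝ) : ℂ) * w ^ k +
          ((((descPochhammer ℝ (m + 1)).eval ((M : ℝ) - 1 / 2) / (Nat.factorial (m + 1) : ℝ)) : ℝ) : ℂ) * w ^ (m + 1) :=
      Finset.sum_range_succ _ _
    rw [e1, e2, mul_add, ih]
    have hrec := succ_mul_halfBinom_succ_complex M m
    simp only [Nat.add_sub_cancel, Nat.cast_add, Nat.cast_one]
    -- name the pieces
    set N : ℂ := ((((M : ℝ) - 1 / 2 : ℝ) : ℂ)) with hN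
    set c0 : ℂ := ((((descPochhammer ℝ m).eval ((M : ℝ) - 1 / 2) / (Nat.factorial m : ℝ)) : ℝ) : ℂ) with hc0
    set c1 : ℂ := ((((descPochhammer ℝ (m + 1)).eval ((M : ℝ) - 1 / 2) / (Nat.factorial (m + 1) : ℝ)) : ℝ) : ℂ) with hc1
    -- (1+w) c1 (m+1) w^m = (N - m) c0 w^m + (m+1) c1 w^{m+1}
    have key : (1 + w) * (c1 * (((m : ℂ) + 1) * w ^ m)) =
        (N - m) * c0 * w ^ m + ((m : ℂ) + 1) * c1 * w ^ (m + 1) := by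
      have : ((m : ℂ) + 1) * c1 = (N - m) * c0 := hrec
      calc (1 + w) * (c1 * (((m : ℂ) + 1) * w ^ m))
          = (((m : ℂ) + 1) * c1) * w ^ m + ((m : ℂ) + 1) * c1 * w ^ (m + 1) := by ring
        _ = (N - m) * c0 * w ^ m + ((m : ℂ) + 1) * c1 * w ^ (m + 1) := by rw [this]
    rw [key]
    ring

/-- **The ODE**: `(1+w)·T_M′(w) − (M−½)·T_M(w) = ½·binom(M−½,M)·w^M` for every `w ∈ ℂ`. -/
theorem ode_truncBinom (M : ℕ) (w : ℂ) :
    (1 + w) * (∑ k ∈ Finset.range (M + 1), ((((descPochhammer ℝ k).eval ((M : ℝ) - 1 / 2) / (Nat.factorial k : ℝ)) : ℝ) : ℂ) * ((k : ℂ) * w ^ (k - 1))) - ((((M : ℝ) - 1 / 2 : ℝ) : ℂ)) * (∑ k ∈ Finset.range (M + 1), ((((descPochhammer ℝ k).eval ((M : ℝ) - 1 / 2) / (Nat.factorial k : ℝ)) : ℝ) : ℂ) * w ^ k) =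
      ((((descPochhammer ℝ M).eval ((M : ℝ) - 1 / 2) / (Nat.factorial M : ℝ)) / 2 : ℝ) : ℂ) * w ^ M := by
  rw [ode_partial M w M]
  push_cast
  ring

/-- The value at the branch point: `T_M(−1) = (−1)^{M+1}·binom(M−½,M)/(2M−1)`. -/
theorem truncBinom_neg_one (M : ℕ) (hM : 1 ≤ M) :
    (∑ k ∈ Finset.range (M + 1), ((((descPochhammer ℝ k).eval ((M : ℝ) - 1 / 2) / (Nat.factorial k : ℝ)) : ℝ) : ℂ) * (-1) ^ k) = (-1) ^ (M + 1) * ((((descPochhammer ℝ M).eval ((M : ℝ) - 1 / 2) / (Nat.factorial M : ℝ)) / (2 * M - 1) : ℝ) : ℂ) := by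
  have h := ode_truncBinom M (-1)
  rw [add_neg_cancel, zero_mul, zero_sub] at h
  have hN : ((((M : ℝ) - 1 / 2 : ℝ) : ℂ)) ≠ 0 := by
    have : (1 : ℝ) ≤ M := by exact_mod_cast hM
    have h2 : ((M : ℝ) - 1 / 2) ≠ 0 := by intro h0; linarith
    exact_mod_cast h2
  have h2M : ((2 * M - 1 : ℝ)) ≠ 0 := by
    have : (1 : ℝ) ≤ M := by exact_mod_cast hM
    intro h0; linarith
  -- from -N T = (C/2)(-1)^M
  have hT : (∑ k ∈ Finset.range (M + 1), ((((descPochhammer ℝ k).eval ((M : ℝ) - 1 / 2) / (Nat.factorial k : ℝ)) : ℝ) : ℂ) * (-1) ^ k) * ((((M : ℝ) - 1 / 2 : ℝ) : ℂ)) = -(((((descPochhammer ℝ M).eval ((M : ℝ) - 1 / 2) / (Nat.factorial M : ℝ)) / 2 : ℝ) : ℂ) * (-1) ^ M) := by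
    linear_combination (-1 : ℂ) * h
  have hT' : (∑ k ∈ Finset.range (M + 1), ((((descPochhammer ℝ k).eval ((M : ℝ) - 1 / 2) / (Nat.factorial k : ℝ)) : ℝ) : ℂ) * (-1) ^ k) = -(((((descPochhammer ℝ M).eval ((M : ℝ) - 1 / 2) / (Nat.factorial M : ℝ)) / 2 : ℝ) : ℂ) * (-1) ^ M) / ((((M : ℝ) - 1 / 2 : ℝ) : ℂ)) := by
    rw [← hT, mul_div_cancel_right₀ _ hN]
  rw [hT']
  have h2M' : (2 * (M : ℂ) - 1) ≠ 0 := by exact_mod_cast h2M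
  have hc : ((((M : ℝ) - 1 / 2 : ℝ) : ℂ)) = (2 * (M : ℂ) - 1) / 2 := by push_cast; ring
  rw [hc]
  push_cast
  field_simp
  ring

/-! ## 3b. The derivative of `G(w) = T_M(w)·(1+w)^{−(M−½)}` off the cut `w ∈ (−∞, −1]` -/



/-- The derivative of `G_M` off the cut: `G_M′(w) = ½·binom(M−½,M)·w^M·(1+w)^{−(M−½)−1}`. -/
theorem hasDerivAt_truncBinomG (M : ℕ) {w : ℂ} (hw : 1 + w ∈ slitPlane) :
    HasDerivAt (fun w : ℂ ↦ ((∑ k ∈ Finset.range (M + 1), ((((descPochhammer ℝ k).eval ((M : ℝ) - 1 / 2) / (Nat.factorial k : ℝ)) : ℝ) : ℂ) * w ^ k) * (1 + w) ^ (-((((M : ℝ) - 1 / 2) : ℝ) : ℂ))))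
      (((((descPochhammer ℝ M).eval ((M : ℝ) - 1 / 2) / (Nat.factorial M : ℝ)) / 2 : ℝ) : ℂ) * w ^ M * (1 + w) ^ (-((((M : ℝ) - 1 / 2) : ℝ) : ℂ) - 1)) w := by
  have h1w : (1 + w) ≠ 0 := slitPlane_ne_zero hw
  have hlin : HasDerivAt (fun y : ℂ ↦ 1 + y) 1 w := (hasDerivAt_id w).const_add 1
  have hpow : HasDerivAt (fun y : ℂ ↦ (1 + y) ^ (-((((M : ℝ) - 1 / 2) : ℝ) : ℂ)))
      ((-((((M : ℝ) - 1 / 2) : ℝ) : ℂ)) * (1 + w) ^ (-((((M : ℝ) - 1 / 2) : ℝ) : ℂ) - 1) * 1) w :=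
    hlin.cpow_const hw
  have hprod := (hasDerivAt_truncBinom M w).mul hpow
  have hode := ode_truncBinom M w
  -- rewrite the derivative
  have key : (∑ k ∈ Finset.range (M + 1), ((((descPochhammer ℝ k).eval ((M : ℝ) - 1 / 2) / (Nat.factorial k : ℝ)) : ℝ) : ℂ) * ((k : ℂ) * w ^ (k - 1))) * (1 + w) ^ (-((((M : ℝ) - 1 / 2) : ℝ) : ℂ)) +
      (∑ k ∈ Finset.range (M + 1), ((((descPochhammer ℝ k).eval ((M : ℝ) - 1 / 2) / (Nat.factorial k : ℝ)) : ℝ) : ℂ) * w ^ k) * ((-((((M : ℝ) - 1 / 2) : ℝ) : ℂ)) * (1 + w) ^ (-((((M : ℝ) - 1 / 2) : ℝ) : ℂ) - 1) * 1) =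
      ((((descPochhammer ℝ M).eval ((M : ℝ) - 1 / 2) / (Nat.factorial M : ℝ)) / 2 : ℝ) : ℂ) * w ^ M * (1 + w) ^ (-((((M : ℝ) - 1 / 2) : ℝ) : ℂ) - 1) := by
    have hsplit : (1 + w) ^ (-((((M : ℝ) - 1 / 2) : ℝ) : ℂ)) = (1 + w) ^ (-((((M : ℝ) - 1 / 2) : ℝ) : ℂ) - 1) * (1 + w) := by
      rw [cpow_sub _ _ h1w, cpow_one]
      field_simp
    rw [hsplit]
    have hode' : (1 + w) * (∑ k ∈ Finset.range (M + 1), ((((descPochhammer ℝ k).eval ((M : ℝ) - 1 / 2) / (Nat.factorial k : ℝ)) : ℝ) : ℂ) * ((k : ℂ) * w ^ (k - 1))) - (((((M : ℝ) - 1 / 2) : ℝ) : ℂ)) * (∑ k ∈ Finset.range (M + 1), ((((descPochhammer ℝ k).eval ((M : ℝ) - 1 / 2) / (Nat.factorial k : ℝ)) : ℝ) : ℂ) * w ^ k) =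
        ((((descPochhammer ℝ M).eval ((M : ℝ) - 1 / 2) / (Nat.factorial M : ℝ)) / 2 : ℝ) : ℂ) * w ^ M := by
      exact hode
    linear_combination ((1 + w) ^ (-((((M : ℝ) - 1 / 2) : ℝ) : ℂ) - 1)) * hode'
  have : HasDerivAt (fun y ↦ (∑ k ∈ Finset.range (M + 1), ((((descPochhammer ℝ k).eval ((M : ℝ) - 1 / 2) / (Nat.factorial k : ℝ)) : ℝ) : ℂ) * y ^ k) * (1 + y) ^ (-((((M : ℝ) - 1 / 2) : ℝ) : ℂ)))
      ((∑ k ∈ Finset.range (M + 1), ((((descPochhammer ℝ k).eval ((M : ℝ) - 1 / 2) / (Nat.factorial k : ℝ)) : ℝ) : ℂ) * ((k : ℂ) * w ^ (k - 1))) * (1 + w) ^ (-((((M : ℝ) - 1 / 2) : ℝ) : ℂ)) +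
        (∑ k ∈ Finset.range (M + 1), ((((descPochhammer ℝ k).eval ((M : ℝ) - 1 / 2) / (Nat.factorial k : ℝ)) : ℝ) : ℂ) * w ^ k) * ((-((((M : ℝ) - 1 / 2) : ℝ) : ℂ)) * (1 + w) ^ (-((((M : ℝ) - 1 / 2) : ℝ) : ℂ) - 1) * 1)) w := hprod
  rw [key] at this
  exact this

/-! ## 4. The segment `[0, r]` -/

/-- `T_M(0) = 1`. -/
theorem truncBinom_zero (M : ℕ) : (∑ k ∈ Finset.range (M + 1), ((((descPochhammer ℝ k).eval ((M : ℝ) - 1 / 2) / (Nat.factorial k : ℝ)) : ℝ) : ℂ) * 0 ^ k) = 1 := by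
  rw [Finset.sum_range_succ']
  simp

/-- `G_M(0) = 1`. -/
theorem truncBinomG_zero (M : ℕ) : ((∑ k ∈ Finset.range (M + 1), ((((descPochhammer ℝ k).eval ((M : ℝ) - 1 / 2) / (Nat.factorial k : ℝ)) : ℝ) : ℂ) * 0 ^ k) * (1 + 0) ^ (-((((M : ℝ) - 1 / 2) : ℝ) : ℂ))) = 1 := by
  rw [truncBinom_zero, add_zero, Complex.one_cpow, one_mul]


/-- Continuity of `G_M′` at points off the cut. -/
theorem continuousAt_truncBinomG' (M : ℕ) {w : ℂ} (hw : 1 + w ∈ slitPlane) :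
    ContinuousAt (fun w : ℂ ↦ (((((descPochhammer ℝ M).eval ((M : ℝ) - 1 / 2) / (Nat.factorial M : ℝ)) / 2 : ℝ) : ℂ) * w ^ M * (1 + w) ^ (-((((M : ℝ) - 1 / 2) : ℝ) : ℂ) - 1))) w := by
  have h1 : ContinuousAt (fun y : ℂ ↦ 1 + y) w := (continuous_const.add continuous_id).continuousAt
  have h2 : ContinuousAt (fun y : ℂ ↦ (1 + y) ^ (-((((M : ℝ) - 1 / 2) : ℝ) : ℂ) - 1)) w :=
    h1.cpow continuousAt_const hw
  exact ((continuousAt_const.mul (continuousAt_id.pow M)).mul h2)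


/-- `0 ≤ I_M(r) ≤ r^{M+1}/(M+1)` for `r ≥ 0`. -/
theorem segInt_bounds (M : ℕ) {r : ℝ} (hr : 0 ≤ r) :
    0 ≤ (∫ x in (0 : ℝ)..r, x ^ M * (1 + x) ^ (-(((M : ℝ) - 1 / 2)) - 1)) ∧ (∫ x in (0 : ℝ)..r, x ^ M * (1 + x) ^ (-(((M : ℝ) - 1 / 2)) - 1)) ≤ r ^ (M + 1) / (M + 1) := by
  have hcont : ContinuousOn (fun x : ℝ ↦ x ^ M * (1 + x) ^ (-(((M : ℝ) - 1 / 2)) - 1)) (Set.Icc 0 r) := by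
    intro x hx
    have h1x : (1 + x) ≠ 0 := by have := hx.1; intro h; linarith
    exact ((continuousAt_id.pow M).mul
      ((continuousAt_const.add continuousAt_id).rpow_const (Or.inl h1x))).continuousWithinAt
  have hle1 : ∀ x ∈ Set.Icc (0 : ℝ) r, x ^ M * (1 + x) ^ (-(((M : ℝ) - 1 / 2)) - 1) ≤ x ^ M := by
    intro x hx
    have hx0 : 0 ≤ x := hx.1
    have hp : (1 + x) ^ (-(((M : ℝ) - 1 / 2)) - 1) ≤ 1 := by
      apply Real.rpow_le_one_of_one_le_of_nonpos (by linarith)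
      have : (0 : ℝ) ≤ ((M : ℝ) - 1 / 2) + 1 := by
        have : (0 : ℝ) ≤ M := by positivity
        linarith
      linarith
    calc x ^ M * (1 + x) ^ (-(((M : ℝ) - 1 / 2)) - 1) ≤ x ^ M * 1 := by
          apply mul_le_mul_of_nonneg_left hp (pow_nonneg hx0 M)
      _ = x ^ M := mul_one _
  have hnn : ∀ x ∈ Set.Icc (0 : ℝ) r, 0 ≤ x ^ M * (1 + x) ^ (-(((M : ℝ) - 1 / 2)) - 1) := by
    intro x hx
    exact mul_nonneg (pow_nonneg hx.1 M) (Real.rpow_nonneg (by linarith [hx.1]) _)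
  refine ⟨intervalIntegral.integral_nonneg hr (fun x hx ↦ hnn x hx), ?_⟩
  have hcont' : ContinuousOn (fun x : ℝ ↦ x ^ M * (1 + x) ^ (-(((M : ℝ) - 1 / 2)) - 1)) (Set.uIcc 0 r) := by
    rwa [Set.uIcc_of_le hr]
  calc (∫ x in (0 : ℝ)..r, x ^ M * (1 + x) ^ (-(((M : ℝ) - 1 / 2)) - 1)) ≤ ∫ x in (0 : ℝ)..r, x ^ M := by
        apply intervalIntegral.integral_mono_on hr hcont'.intervalIntegrable
          (intervalIntegral.intervalIntegrable_pow M)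
        exact hle1
    _ = r ^ (M + 1) / (M + 1) := by rw [integral_pow]; simp

/-- On `[0, r]` the complex derivative `G_M′(x)` is the real integrand of `I_M`, times `½·binom(M−½,M)`. -/
theorem truncBinomG'_ofReal (M : ℕ) {x : ℝ} (hx : 0 ≤ x) :
    (((((descPochhammer ℝ M).eval ((M : ℝ) - 1 / 2) / (Nat.factorial M : ℝ)) / 2 : ℝ) : ℂ) * (x : ℂ) ^ M * (1 + (x : ℂ)) ^ (-((((M : ℝ) - 1 / 2) : ℝ) : ℂ) - 1)) = (((((descPochhammer ℝ M).eval ((M : ℝ) - 1 / 2) / (Nat.factorial M : ℝ)) / 2) * (x ^ M * (1 + x) ^ (-(((M : ℝ) - 1 / 2)) - 1)) : ℝ) : ℂ) := by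
  have h1x : (0 : ℝ) ≤ 1 + x := by linarith
  have hc : ((1 : ℂ) + (x : ℂ)) ^ (-((((M : ℝ) - 1 / 2) : ℝ) : ℂ) - 1) = (((1 + x) ^ (-(((M : ℝ) - 1 / 2)) - 1) : ℝ) : ℂ) := by
    rw [Complex.ofReal_cpow h1x]
    push_cast
    ring_nf
  rw [hc]
  push_cast
  ring

/-- **Segment identity**: `G_M(r) = 1 + ½·binom(M−½,M)·I_M(r)` for real `r ≥ 0`. -/
theorem truncBinomG_ofReal (M : ℕ) {r : ℝ} (hr : 0 ≤ r) :
    ((∑ k ∈ Finset.range (M + 1), ((((descPochhammer ℝ k).eval ((M : ℝ) - 1 / 2) / (Nat.factorial k : ℝ)) : ℝ) : ℂ) * (r : ℂ) ^ k) * (1 + (r : ℂ)) ^ (-((((M : ℝ) - 1 / 2) : ℝ) : ℂ))) = 1 + (((((descPochhammer ℝ M).eval ((M : ℝ) - 1 / 2) / (Nat.factorial M : ℝ)) / 2) * (∫ x in (0 : ℝ)..r, x ^ M * (1 + x) ^ (-(((M : ℝ) - 1 / 2)) - 1)) : ℝ) : ℂ) := by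
  have hslit : ∀ x ∈ Set.uIcc (0 : ℝ) r, (1 : ℂ) + (x : ℂ) ∈ slitPlane := by
    intro x hx
    rw [Set.uIcc_of_le hr] at hx
    have : (1 : ℂ) + (x : ℂ) = (((1 + x : ℝ)) : ℂ) := by push_cast; ring
    rw [this, Complex.ofReal_mem_slitPlane]
    linarith [hx.1]
  have hderiv : ∀ x ∈ Set.uIcc (0 : ℝ) r, HasDerivAt (fun y : ℝ ↦ ((∑ k ∈ Finset.range (M + 1), ((((descPochhammer ℝ k).eval ((M : ℝ) - 1 / 2) / (Nat.factorial k : ℝ)) : ℝ) : ℂ) * (y : ℂ) ^ k) * (1 + (y : ℂ)) ^ (-((((M : ℝ) - 1 / 2) : ℝ) : ℂ)))) ((((((descPochhammer ℝ M).eval ((M : ℝ) - 1 / 2) / (Nat.factorial M : ℝ)) / 2 : ℝ) : ℂ) * (x : ℂ) ^ M * (1 + (x : ℂ)) ^ (-((((M : ℝ) - 1 / 2) : ℝ) : ℂ) - 1))) x := by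
    intro x hx
    have h := hasDerivAt_truncBinomG M (hslit x hx)
    have h2 : HasDerivAt (fun y : ℝ ↦ ((∑ k ∈ Finset.range (M + 1), ((((descPochhammer ℝ k).eval ((M : ℝ) - 1 / 2) / (Nat.factorial k : ℝ)) : ℝ) : ℂ) * (y : ℂ) ^ k) * (1 + (y : ℂ)) ^ (-((((M : ℝ) - 1 / 2) : ℝ) : ℂ)))) ((((((descPochhammer ℝ M).eval ((M : ℝ) - 1 / 2) / (Nat.factorial M : ℝ)) / 2 : ℝ) : ℂ) * (x : ℂ) ^ M * (1 + (x : ℂ)) ^ (-((((M : ℝ) - 1 / 2) : ℝ) : ℂ) - 1)) * 1) x :=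
      h.comp x ((hasDerivAt_id x).ofReal_comp)
    simpa using h2
  have hcontR : ContinuousOn (fun x : ℝ ↦ (((((descPochhammer ℝ M).eval ((M : ℝ) - 1 / 2) / (Nat.factorial M : ℝ)) / 2 : ℝ) : ℂ) * (x : ℂ) ^ M * (1 + (x : ℂ)) ^ (-((((M : ℝ) - 1 / 2) : ℝ) : ℂ) - 1))) (Set.uIcc 0 r) := by
    intro x hx
    exact ((continuousAt_truncBinomG' M (hslit x hx)).comp Complex.continuous_ofReal.continuousAt).continuousWithinAt
  have hint : IntervalIntegrable (fun x : ℝ ↦ (((((descPochhammer ℝ M).eval ((M : ℝ) - 1 / 2) / (Nat.factorial M : ℝ)) / 2 : ℝ) : ℂ) * (x : ℂ) ^ M * (1 + (x : ℂ)) ^ (-((((M : ℝ) - 1 / 2) : ℝ) : ℂ) - 1))) volume 0 r := hcontR.intervalIntegrable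
  have hftc := intervalIntegral.integral_eq_sub_of_hasDerivAt hderiv hint
  -- ∫₀^r G′(x) dx = G(r) − G(0)
  have hG0 : ((∑ k ∈ Finset.range (M + 1), ((((descPochhammer ℝ k).eval ((M : ℝ) - 1 / 2) / (Nat.factorial k : ℝ)) : ℝ) : ℂ) * ((0 : ℝ) : ℂ) ^ k) * (1 + ((0 : ℝ) : ℂ)) ^ (-((((M : ℝ) - 1 / 2) : ℝ) : ℂ))) = 1 := by
    rw [Complex.ofReal_zero]; exact truncBinomG_zero M
  rw [hG0] at hftc
  -- the integral is real
  have hreal : (∫ x in (0 : ℝ)..r, (((((descPochhammer ℝ M).eval ((M : ℝ) - 1 / 2) / (Nat.factorial M : ℝ)) / 2 : ℝ) : ℂ) * (x : ℂ) ^ M * (1 + (x : ℂ)) ^ (-((((M : ℝ) - 1 / 2) : ℝ) : ℂ) - 1))) =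
      (((((descPochhammer ℝ M).eval ((M : ℝ) - 1 / 2) / (Nat.factorial M : ℝ)) / 2) * (∫ x in (0 : ℝ)..r, x ^ M * (1 + x) ^ (-(((M : ℝ) - 1 / 2)) - 1)) : ℝ) : ℂ) := by
    have heq : Set.EqOn (fun x : ℝ ↦ (((((descPochhammer ℝ M).eval ((M : ℝ) - 1 / 2) / (Nat.factorial M : ℝ)) / 2 : ℝ) : ℂ) * (x : ℂ) ^ M * (1 + (x : ℂ)) ^ (-((((M : ℝ) - 1 / 2) : ℝ) : ℂ) - 1)))
        (fun x : ℝ ↦ ((((((descPochhammer ℝ M).eval ((M : ℝ) - 1 / 2) / (Nat.factorial M : ℝ)) / 2) * (x ^ M * (1 + x) ^ (-(((M : ℝ) - 1 / 2)) - 1)) : ℝ) : ℂ)))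
        (Set.uIcc 0 r) := by
      intro x hx
      rw [Set.uIcc_of_le hr] at hx
      exact truncBinomG'_ofReal M hx.1
    rw [intervalIntegral.integral_congr heq, intervalIntegral.integral_ofReal,
      ← intervalIntegral.integral_const_mul]
  rw [hreal] at hftc
  linear_combination (-1 : ℂ) * hftc

end Summit.RiemannHypothesis.RiemannHypothesis.Theorems.JensenPolynomials.WindowEGF
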